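import Summits.ResolutionOfSingularities.ResolutionOfSingularities.Theorems.PurelyInseparableDim4SpivakovskySelect
import Summits.ResolutionOfSingularities.ResolutionOfSingularities.Theorems.PurelyInseparableDim4SpivakovskyMove
import HarnessLib

/-!
# [OURS · res-dim4-pi PR-9c, Remark 2] Lemma 2 for the strategy with an arbitrary minimal one-vertex choice

Cell `res-dim4-pi` (D-0157 DOOR 2), seat `res-dim4-p-11`; desk WORD #32 (d)(i).  Def-free.  The file
`…SpivakovskyMove` (Lemma 2 (a)(b)(c) of [cite: Spivakovsky1983, §III Lemma 2]) re-threaded for `stratWith mp` with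
`hmp : IsMinPermSel mp` (any selector of a minimal permissible `Γ_r`, source Remark 2): `dG_stratWith_eq`, Claim (1)
`sub_omega_move_self_sel` / `sum_sub_omega_move_sel`, (a) `dt_image_move_le_sub_sel` / `dt_image_move_le_sel`,
(b) `dt_image_move_lt_of_mem_Sset_sel`, `not_mem_Sset_of_dt_eq_sel`, `sum_move_eq_dG_of_min_sel`,
`Sset_subset_Sset_image_move_sel`, (c) `move_smul_tilde_sel`, `Hset_image_move_sel`, `derive_image_move_sel`,
`stratWith_image_move`.  The selector-free lemmas (`omega_image_move_*`, `sub_omega_move_of_ne`, `proj_move`, …) are the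
tree's (`…SpivakovskyMove`).

[OURS · counted 0 · AI work weaker than expert review] Kernel transcription of a 1983 combinatorial theorem used by OUR
frame's spine game; NOTHING here is a theorem about resolution of singularities in dimension ≥ 4 / characteristic `p`.
bears_on: LADDER-RESOLUTION:D157-DOOR2 (res-dim4-pi · PR-9c Remark 2). Supports stmt-ResolutionOfSingularities-16155 (helper).
-/

set_option linter.dupNamespace false -- mandated namespace of this single-conjunct summit

open Finset
open scoped BigOperators

namespace Summit.ResolutionOfSingularities.ResolutionOfSingularities.Theorems.PIDim4

namespace Spivakovsky

variable {σ : Type} [Fintype σ] [DecidableEq σ]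

section Move

variable {mp : Finset σ → Pos σ → Finset σ} {I Γ : Finset σ} {G : Pos σ} {i : σ}

/-! ## §1 The new `ω` and Claim (1) -/

/-- **`d_Γ(G) = d(G̃) + Σ_Γ ω`** for the strategy's `Γ` (Lemma 1 (b): `d_Γ(G̃) = d(G̃)`).
[cite: Spivakovsky1983, §III Lemma 1 (b), Claim (1)] -/
theorem dG_stratWith_eq (hmp : IsMinPermSel mp) (hgood : Good I G) (hd : 1 ≤ dG I G) (hdt : dt I G ≠ 0) :
    dG (stratWith mp I G) G = dt I G + ∑ j ∈ stratWith mp I G, omega G j := by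
  have hG := hgood.1
  apply le_antisymm
  · obtain ⟨v, hv, hvd⟩ := exists_dG_eq I hG
    have h1 : ∑ j ∈ stratWith mp I G, (v - omega G) j ≤ dt I G := by
      rw [← sum_tilde_eq_dt_of_min hG hvd]
      exact sum_tilde_le_of_subset (stratWith_subset hmp hgood hd) hv
    calc dG (stratWith mp I G) G ≤ ∑ j ∈ stratWith mp I G, v j := dG_le _ hv
      _ = ∑ j ∈ stratWith mp I G, (v - omega G) j + ∑ j ∈ stratWith mp I G, omega G j := by
          rw [sum_sub_omega]; ring
      _ ≤ dt I G + ∑ j ∈ stratWith mp I G, omega G j := by linarith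
  · apply le_dG _ hG
    intro g hg
    have h1 := dt_le_sum_stratWith_tilde hmp hgood hd hdt hg
    rw [sum_sub_omega] at h1
    linarith

/-- **Claim (1), at the pivot**: `(σ_{Γ,i}(g) − ω')_i = Σ_Γ g̃ − d(G̃)` for the strategy's `Γ`.
[cite: Spivakovsky1983, §III Claim (1)] -/
theorem sub_omega_move_self_sel (hmp : IsMinPermSel mp) (hgood : Good I G) (hd : 1 ≤ dG I G) (hdt : dt I G ≠ 0) (g : σ → ℚ) :
    (move (stratWith mp I G) i g - omega (G.image (move (stratWith mp I G) i))) i =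
      ∑ j ∈ stratWith mp I G, (g - omega G) j - dt I G := by
  simp only [Pi.sub_apply, move_apply_self, omega_image_move_self hgood.1, dG_stratWith_eq hmp hgood hd hdt,
    Finset.sum_sub_distrib]
  ring

/-- The tilde-sum of a moved generator: `|σ(g) − ω'|_I = Σ_{I∖i} g̃ + (Σ_Γ g̃ − d(G̃))`.
[cite: Spivakovsky1983, §III proof of Lemma 2 (a)] -/
theorem sum_sub_omega_move_sel (hmp : IsMinPermSel mp) (hgood : Good I G) (hd : 1 ≤ dG I G) (hdt : dt I G ≠ 0)
    (hi : i ∈ stratWith mp I G) (g : σ → ℚ) :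
    ∑ k ∈ I, (move (stratWith mp I G) i g - omega (G.image (move (stratWith mp I G) i))) k =
      ∑ k ∈ I.erase i, (g - omega G) k + (∑ j ∈ stratWith mp I G, (g - omega G) j - dt I G) := by
  have hiI : i ∈ I := stratWith_subset hmp hgood hd hi
  rw [← Finset.add_sum_erase I _ hiI, sub_omega_move_self_sel hmp hgood hd hdt g, add_comm]
  congr 1
  exact Finset.sum_congr rfl fun k hk => sub_omega_move_of_ne hgood.1 (Finset.ne_of_mem_erase hk)

/-! ## §2 Lemma 2 (a) and (b) -/

/-- **Lemma 2 (a), sharp form**: for every minimising generator `v` (`|v|_I = d(G)`),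
`d(G̃') ≤ d(G̃) − ṽ_i`. [cite: Spivakovsky1983, §III Lemma 2 (a), (2)] -/
theorem dt_image_move_le_sub_sel (hmp : IsMinPermSel mp) (hgood : Good I G) (hd : 1 ≤ dG I G) (hdt : dt I G ≠ 0)
    (hi : i ∈ stratWith mp I G) {v : σ → ℚ} (hv : v ∈ G) (hvd : ∑ k ∈ I, v k = dG I G) :
    dt I (G.image (move (stratWith mp I G) i)) ≤ dt I G - (v - omega G) i := by
  have hG := hgood.1
  have hiI : i ∈ I := stratWith_subset hmp hgood hd hi
  have hvt : ∑ k ∈ I, (v - omega G) k = dt I G := sum_tilde_eq_dt_of_min hG hvd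
  have hΓ : ∑ j ∈ stratWith mp I G, (v - omega G) j ≤ dt I G := by
    rw [← hvt]; exact sum_tilde_le_of_subset (stratWith_subset hmp hgood hd) hv
  have herase : ∑ k ∈ I.erase i, (v - omega G) k = dt I G - (v - omega G) i := by
    rw [← hvt, ← Finset.add_sum_erase I _ hiI]; ring
  calc dt I (G.image (move (stratWith mp I G) i))
      ≤ ∑ k ∈ I, (move (stratWith mp I G) i v - omega (G.image (move (stratWith mp I G) i))) k :=
        dG_le I (sub_omega_mem_tilde (Finset.mem_image_of_mem _ hv))
    _ = ∑ k ∈ I.erase i, (v - omega G) k + (∑ j ∈ stratWith mp I G, (v - omega G) j - dt I G) :=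
        sum_sub_omega_move_sel hmp hgood hd hdt hi v
    _ ≤ dt I G - (v - omega G) i := by rw [herase]; linarith

/-- **Lemma 2 (a)**: `d(G̃') ≤ d(G̃)` — A keeps the first numerical character from increasing.
[cite: Spivakovsky1983, §III Lemma 2 (a)] -/
theorem dt_image_move_le_sel (hmp : IsMinPermSel mp) (hgood : Good I G) (hd : 1 ≤ dG I G) (hdt : dt I G ≠ 0) (hi : i ∈ stratWith mp I G) :
    dt I (G.image (move (stratWith mp I G) i)) ≤ dt I G := by
  obtain ⟨v, hv, hvd⟩ := exists_dG_eq I hgood.1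
  have h := dt_image_move_le_sub_sel hmp hgood hd hdt hi hv hvd
  have h0 : 0 ≤ (v - omega G) i := tilde_nonneg (sub_omega_mem_tilde hv) i
  linarith

/-- **Lemma 2 (b), first half (contrapositive)**: if B's answer `i` lies in `S(G)` then `d(G̃') < d(G̃)`.
[cite: Spivakovsky1983, §III Lemma 2 (b)] -/
theorem dt_image_move_lt_of_mem_Sset_sel (hmp : IsMinPermSel mp) (hgood : Good I G) (hd : 1 ≤ dG I G) (hdt : dt I G ≠ 0)
    (hi : i ∈ stratWith mp I G) (hiS : i ∈ Sset I G) :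
    dt I (G.image (move (stratWith mp I G) i)) < dt I G := by
  obtain ⟨-, w, hw, hwd, hwi⟩ := mem_Sset_iff.mp hiS
  have h := dt_image_move_le_sub_sel hmp hgood hd hdt hi hw hwd
  have h0 : 0 < (w - omega G) i := by
    rcases (tilde_nonneg (sub_omega_mem_tilde hw) i).lt_or_eq with h | h
    · exact h
    · exfalso; apply hwi; simp only [Pi.sub_apply] at h; linarith
  linarith

/-- **Lemma 2 (b)**: `d(G̃') = d(G̃) ⇒ i ∉ S(G)`. [cite: Spivakovsky1983, §III Lemma 2 (b)] -/
theorem not_mem_Sset_of_dt_eq_sel (hmp : IsMinPermSel mp) (hgood : Good I G) (hd : 1 ≤ dG I G) (hdt : dt I G ≠ 0)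
    (hi : i ∈ stratWith mp I G) (heq : dt I (G.image (move (stratWith mp I G) i)) = dt I G) : i ∉ Sset I G :=
  fun hiS => absurd heq (ne_of_lt (dt_image_move_lt_of_mem_Sset_sel hmp hgood hd hdt hi hiS))

/-- A minimiser `w` with `w̃_i = 0` moves to a minimiser: `|σ(w) − ω'|_I = Σ_Γ w̃ = d(G̃)`.
[cite: Spivakovsky1983, §III proof of Lemma 2 (b)] -/
theorem sum_move_eq_dG_of_min_sel (hmp : IsMinPermSel mp) (hgood : Good I G) (hd : 1 ≤ dG I G) (hdt : dt I G ≠ 0)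
    (hi : i ∈ stratWith mp I G) (heq : dt I (G.image (move (stratWith mp I G) i)) = dt I G)
    {w : σ → ℚ} (hw : w ∈ G) (hwd : ∑ k ∈ I, w k = dG I G) :
    ∑ k ∈ I, move (stratWith mp I G) i w k = dG I (G.image (move (stratWith mp I G) i)) := by
  have hG := hgood.1
  have hiI : i ∈ I := stratWith_subset hmp hgood hd hi
  have hiS := not_mem_Sset_of_dt_eq_sel hmp hgood hd hdt hi heq
  have hwi : (w - omega G) i = 0 := by
    rw [Pi.sub_apply, eq_omega_of_not_mem_Sset hiI hiS hw hwd, sub_self]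
  have hwt : ∑ k ∈ I, (w - omega G) k = dt I G := sum_tilde_eq_dt_of_min hG hwd
  have hle : ∑ j ∈ stratWith mp I G, (w - omega G) j ≤ dt I G := by
    rw [← hwt]; exact sum_tilde_le_of_subset (stratWith_subset hmp hgood hd) hw
  have hge : dt I G ≤ ∑ j ∈ stratWith mp I G, (w - omega G) j := dt_le_sum_stratWith_tilde hmp hgood hd hdt hw
  have herase : ∑ k ∈ I.erase i, (w - omega G) k = dt I G - (w - omega G) i := by
    rw [← hwt, ← Finset.add_sum_erase I _ hiI]; ring
  have htilde : ∑ k ∈ I, (move (stratWith mp I G) i w - omega (G.image (move (stratWith mp I G) i))) k = dt I G := by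
    rw [sum_sub_omega_move_sel hmp hgood hd hdt hi w, herase, hwi]; linarith
  rw [sum_sub_omega] at htilde
  have h2 := dt_eq I (hG.image (move (stratWith mp I G) i))
  rw [heq] at h2
  linarith

/-- **Lemma 2 (b), second half**: `d(G̃') = d(G̃) ⇒ S(G) ⊆ S(G')`. [cite: Spivakovsky1983, §III Lemma 2 (b)] -/
theorem Sset_subset_Sset_image_move_sel (hmp : IsMinPermSel mp) (hgood : Good I G) (hd : 1 ≤ dG I G) (hdt : dt I G ≠ 0)
    (hi : i ∈ stratWith mp I G) (heq : dt I (G.image (move (stratWith mp I G) i)) = dt I G) :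
    Sset I G ⊆ Sset I (G.image (move (stratWith mp I G) i)) := by
  intro j hj
  obtain ⟨hjI, w, hw, hwd, hwj⟩ := mem_Sset_iff.mp hj
  have hiS := not_mem_Sset_of_dt_eq_sel hmp hgood hd hdt hi heq
  have hji : j ≠ i := fun h => hiS (h ▸ hj)
  refine mem_Sset_iff.mpr ⟨hjI, move (stratWith mp I G) i w, Finset.mem_image_of_mem _ hw,
    sum_move_eq_dG_of_min_sel hmp hgood hd hdt hi heq hw hwd, ?_⟩
  rwa [move_apply_of_ne _ hji, omega_image_move_of_ne hgood.1 hji]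

/-! ## §3 Lemma 2 (c): the derived position moves by the level-1 strategy -/

/-- Scaling commutes with Claim (1): `σ_{Γ,i}(g̃/d) = (σ_{Γ,i}(g) − ω')/d` when `d(G̃') = d(G̃) = d`.
[cite: Spivakovsky1983, §III proof of (4)] -/
theorem move_smul_tilde_sel (hmp : IsMinPermSel mp) (hgood : Good I G) (hd : 1 ≤ dG I G) (hdt : dt I G ≠ 0) (g : σ → ℚ) :
    move (stratWith mp I G) i ((dt I G)⁻¹ • (g - omega G)) =
      (dt I G)⁻¹ • (move (stratWith mp I G) i g - omega (G.image (move (stratWith mp I G) i))) := by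
  funext k
  by_cases hk : k = i
  · subst hk
    rw [move_apply_self, Pi.smul_apply, sub_omega_move_self_sel hmp hgood hd hdt g, smul_eq_mul]
    simp only [Pi.smul_apply, smul_eq_mul, ← Finset.mul_sum]
    field_simp
  · rw [move_apply_of_ne _ hk, Pi.smul_apply, Pi.smul_apply, sub_omega_move_of_ne hgood.1 hk]

/-- **`H' = σ_{Γ,i}(H)`** as finite sets, when `d(G̃') = d(G̃)`. [cite: Spivakovsky1983, §III (3)–(4)] -/
theorem Hset_image_move_sel (hmp : IsMinPermSel mp) (hgood : Good I G) (hd : 1 ≤ dG I G) (hdt : dt I G ≠ 0)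
    (heq : dt I (G.image (move (stratWith mp I G) i)) = dt I G) :
    Hset I (G.image (move (stratWith mp I G) i)) = (Hset I G).image (move (stratWith mp I G) i) := by
  ext h'
  constructor
  · intro hh'
    apply Finset.mem_image.mpr
    rcases mem_Hset_iff.mp hh' with hg' | ⟨x', hx', hx'eq⟩
    · obtain ⟨g, hg, rfl⟩ := Finset.mem_image.mp hg'
      exact ⟨g, mem_Hset_of_mem hg, rfl⟩
    · obtain ⟨g', hg', rfl⟩ := mem_tilde_iff.mp hx'
      obtain ⟨g, hg, rfl⟩ := Finset.mem_image.mp hg'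
      refine ⟨(dt I G)⁻¹ • (g - omega G), smul_tilde_mem_Hset hg, ?_⟩
      rw [move_smul_tilde_sel hmp hgood hd hdt g, ← heq, hx'eq]
  · intro hh'
    obtain ⟨h, hh, rfl⟩ := Finset.mem_image.mp hh'
    apply mem_Hset_iff.mpr
    rcases mem_Hset_iff.mp hh with hg | ⟨x, hx, rfl⟩
    · exact Or.inl (Finset.mem_image_of_mem _ hg)
    · obtain ⟨g, hg, rfl⟩ := mem_tilde_iff.mp hx
      refine Or.inr ⟨move (stratWith mp I G) i g - omega (G.image (move (stratWith mp I G) i)),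
        sub_omega_mem_tilde (Finset.mem_image_of_mem _ hg), ?_⟩
      rw [heq, move_smul_tilde_sel hmp hgood hd hdt g]

/-- **Lemma 2 (c) on generator sets**: if `d(G̃') = d(G̃)`, `S(G') = S(G)` and `G₁ ≠ ∅`, then
`G'₁ = σ_{Γ₁,i}(G₁)` with `Γ₁ = strat I₁ G₁` (the source's `Δ'₁ = [σ_{Γ₁,i}(Δ₁)]`).
[cite: Spivakovsky1983, §III Lemma 2 (c)] -/
theorem derive_image_move_sel (hmp : IsMinPermSel mp) (hgood : Good I G) (hd : 1 ≤ dG I G) (hdt : dt I G ≠ 0) (hi : i ∈ stratWith mp I G)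
    (heq : dt I (G.image (move (stratWith mp I G) i)) = dt I G)
    (hS : Sset I (G.image (move (stratWith mp I G) i)) = Sset I G) (hne : (derive I G).Nonempty) :
    derive I (G.image (move (stratWith mp I G) i)) =
      (derive I G).image (move (stratWith mp (I1 I G) (derive I G)) i) := by
  set Γ₁ := stratWith mp (I1 I G) (derive I G) with hΓ₁
  have hlt := card_I1_lt hgood hdt
  have hgood₁ : Good (I1 I G) (derive I G) := good_derive hgood hne
  have hd₁ : 1 ≤ dG (I1 I G) (derive I G) := one_le_dG_derive hgood hd hdt hne
  have hΓ₁J : Γ₁ ⊆ I1 I G := stratWith_subset hmp hgood₁ hd₁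
  have hdisj : Disjoint (Sset I G) Γ₁ := (Finset.disjoint_sdiff (s := Sset I G) (t := I)).mono_right hΓ₁J
  have hΓ : stratWith mp I G = Sset I G ∪ Γ₁ := stratWith_eq_union hgood hdt hne
  have hiS : i ∉ Sset I G := not_mem_Sset_of_dt_eq_sel hmp hgood hd hdt hi heq
  have hi₁ : i ∈ Γ₁ := by
    have := hi; rw [hΓ, Finset.mem_union] at this
    exact this.resolve_left hiS
  have hI1 : I1 I (G.image (move (stratWith mp I G) i)) = I1 I G := by rw [I1, I1, hS]
  -- unfold `derive` on both sides and push the move through filter and projection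
  rw [derive, derive, hS, hI1, Hset_image_move_sel hmp hgood hd hdt heq, Finset.filter_image, Finset.image_image,
    Finset.image_image]
  have hfilter : ((Hset I G).filter (fun h => ∑ j ∈ Sset I G, move (stratWith mp I G) i h j < 1)) =
      (Hset I G).filter (fun h => ∑ j ∈ Sset I G, h j < 1) :=
    Finset.filter_congr fun h _ => by rw [sum_Sset_move_of_not_mem hiS]
  rw [hfilter]
  apply Finset.image_congr
  intro h hh
  have hlt1 : ∑ j ∈ Sset I G, h j < 1 := (Finset.mem_filter.mp hh).2
  show (proj (Sset I G) (I1 I G) ∘ move (stratWith mp I G) i) h = (move Γ₁ i ∘ proj (Sset I G) (I1 I G)) h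
  simp only [Function.comp_apply]
  rw [hΓ]
  exact proj_move hdisj hΓ₁J hi₁ hlt1

/-- After such a move the strategy unfolds with the SAME `S` and the moved derived set:
`stratWith mp I G' = S(G) ∪ strat I₁ G'₁`, and B's answer lies in the level-1 strategy. [cite: Spivakovsky1983, §III p. 432] -/
theorem stratWith_image_move (hmp : IsMinPermSel mp) (hgood : Good I G) (hd : 1 ≤ dG I G) (hdt : dt I G ≠ 0) (hi : i ∈ stratWith mp I G)
    (hgood' : Good I (G.image (move (stratWith mp I G) i)))
    (heq : dt I (G.image (move (stratWith mp I G) i)) = dt I G)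
    (hS : Sset I (G.image (move (stratWith mp I G) i)) = Sset I G) (hne : (derive I G).Nonempty) :
    stratWith mp I (G.image (move (stratWith mp I G) i)) =
        Sset I G ∪ stratWith mp (I1 I G) (derive I (G.image (move (stratWith mp I G) i))) ∧
      i ∈ stratWith mp (I1 I G) (derive I G) := by
  have hdt' : dt I (G.image (move (stratWith mp I G) i)) ≠ 0 := by rwa [heq]
  have hne' : (derive I (G.image (move (stratWith mp I G) i))).Nonempty := by
    rw [derive_image_move_sel hmp hgood hd hdt hi heq hS hne]; exact hne.image _
  have hI1 : I1 I (G.image (move (stratWith mp I G) i)) = I1 I G := by rw [I1, I1, hS]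
  have hiS : i ∉ Sset I G := not_mem_Sset_of_dt_eq_sel hmp hgood hd hdt hi heq
  refine ⟨by rw [stratWith_eq_union hgood' hdt' hne', hS, hI1], ?_⟩
  have := hi
  rw [stratWith_eq_union hgood hdt hne, Finset.mem_union] at this
  exact this.resolve_left hiS

end Move

end Spivakovsky

end Summit.ResolutionOfSingularities.ResolutionOfSingularities.Theorems.PIDim4
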